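import Literature.AlgebraicGeometry.HodgeTheory.TautologicalCocycleLinEquivUnits
import Literature.AlgebraicGeometry.HodgeTheory.ChernCharacterClass
import Literature.AlgebraicGeometry.HodgeTheory.GAGALineBundlesOfSections
import Literature.Geometry.Kaehler.ChernCharacterCocycleIso
import Literature.Geometry.Kaehler.HolomorphicLineBundleMetric
import HarnessLib

/-!
# Linear equivalence of hyperplane divisors transports to `ch₁` of the tautological cocycles

Family `hodge`, layer `Literature/AlgebraicGeometry/HodgeTheory`. The dictionary "Cartier divisors ↔ line
cocycles ↔ Chern–Weil classes" for the hyperplane divisors of two morphisms of a smooth projective `T/ℂ`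
(Hodge model `A`) to projective spaces: a closed immersion `Ψ : T ⟶ ℙᴷ`, whose tautological cocycle
`𝒪(-1)|_T` (`AnalytificationKaehler.tautologicalBundle Ψ`, transition functions `Ψ^*(x_a/x_b)`) is the
cocycle `𝒪_T(-D_Ψ)^an` of the hyperplane divisor `D_Ψ = (Ψ^*x_{j₀})` (`GeneratingSections.divisor`, local
equations `F_a = Ψ^*(x_{j₀}/x_a)`, so that `Ψ^*(x_a/x_b) = F_b/F_a`), and a dominant `ψ : T ⟶ ℙᴺ`, whose
pulled-back tautological cocycle `(ψ^an)⁻¹𝒪_{ℙᴺ}(-1)` (`SmoothComplexVectorBundle.pullback` along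
`HodgeModel.anMap`, transition functions `ψ^*(xᵢ/xⱼ) = f_j/f_i`) is `𝒪_T(-ψ^*H)^an` for the pulled-back
hyperplane divisor `ψ^*H` (`CartierDivisor.pullback` of `ProjSpace.hyperplane`, `f_i = ψ^*(x₀/xᵢ)`).
PROVED here:

* `HolomorphicLineBundle.HermitianMetric.exists_localChernForm_eq_smul_of_pow`,
  `HodgeModel.chernCharacter_toSmoothCocycle_eq_smul_of_pow` — **`ch₁(L^{⊗m}) = m • ch₁(L)`** for a line
  cocycle `L' = L^{⊗m}` on the cover of `L` with transition functions `g_ij^m` (Voisin I, §3.3.1: the metric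
  `h^{⊗m}` has Chern form `(1/2iπ) ∂∂̄ log h_i^m = m · (1/2iπ) ∂∂̄ log h_i`; Chern–Weil through
  `HodgeModel.pullback_chernCharacter` and `HermitianMetric.isChernCharacterForm_of_isChernForm`);
* `analyticallyEquivalent_tautologicalBundle_pullback_of_linEquiv` — **`ψ^*H ∼ m • D_Ψ` makes
  `(ψ^an)⁻¹𝒪_{ℙᴺ}(-1)` holomorphically isomorphic to `(𝒪(-1)|_T)^{⊗m}`** (Görtz–Wedhorn I, Prop. 11.21:
  `CaCl ≅ Pic`, read on `T^an`): the matrices of the `CocycleIso` (Fritzsche–Grauert IV §2 (C)) are the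
  units `λ_{a i} = f_i h / F_a^m` of the linear equivalence (`TautologicalCocycleLinEquivUnits`), regular
  hence holomorphic (Serre, GAGA §2 n°6), and (C) `λ_{a i} f_j/f_i = (F_b/F_a)^m λ_{b j}` is an identity in
  `K(T)`;
* `HodgeModel.chernCharacter_tautologicalBundle_pullback_eq_smul_of_linEquiv` — hence
  **`ch₁((ψ^an)⁻¹𝒪_{ℙᴺ}(-1)) = m • ch₁(𝒪(-1)|_T)` in `H²(T(ℂ); ℂ)`** (`CocycleIso.chernCharacterDeRham_eq`:
  isomorphic cocycles have equal Chern characters, Kobayashi II §1; `A.pullback` is injective). With the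
  projective Noether normalisation `ψ` of `CartierDivisor.IsAmple.exists_finite_surjective_linEquiv` this
  expresses the pull-back of the hyperplane class of `ℙᴺ` along a finite surjective `ψ : T ⟶ ℙ^{dim T}` as
  a positive multiple of the hyperplane class of `T ⊆ ℙᴷ`.

Everything is proved; no definitions (the tensor power enters through the hypotheses "same cover,
transition functions `g_ij^m`"), no named facts.

## References

* C. Voisin, *Hodge Theory and Complex Algebraic Geometry I* (2002), §3.3.1, §3.3.2, Thm. 4.49, Thm. 7.10,
  §11.1.2, Thm. 11.33. [VoisinHodgeI2002]
* U. Görtz, T. Wedhorn, *Algebraic Geometry I*, 2nd ed. (2020), (11.9), Prop. 11.21, Def. 11.49. [GortzWedhorn2020]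
* S. Kobayashi, *Differential Geometry of Complex Vector Bundles* (1987), Ch. II §1 Axiom 2, §2 Thm. 2.16.
  [Kobayashi1987]
* J.-P. Serre, *Géométrie algébrique et géométrie analytique* (1956), §2 n°6, §3 n°9. [SerreGAGA1956]
* K. Fritzsche, H. Grauert, *From Holomorphic Functions to Complex Manifolds* (2002), Ch. IV §2.
  [FritzscheGrauert2002]
-/

noncomputable section

open scoped Manifold ContDiff Topology
open CategoryTheory AlgebraicGeometry TopologicalSpace Opposite Set

namespace Literature.AlgebraicGeometry.HodgeTheory

open Literature.AlgebraicGeometry.Motives Literature.AlgebraicGeometry.Motives.RatFn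
  Literature.AlgebraicGeometry.Motives.AlgPoints Literature.AlgebraicGeometry.Motives.AnalytificationKaehler
  Literature.NumberTheory.Transcendental Literature.Geometry.Kaehler

/-! ### The Chern form of a tensor power -/

section Power

variable {ι : Type*} {E : Type*} [NormedAddCommGroup E] [NormedSpace ℂ E]
  {M : Type*} [TopologicalSpace M] [ChartedSpace E M] {L L' : HolomorphicLineBundle ι E M}

/-- **The metric `h^{⊗m}` on a tensor power `L' = L^{⊗m}`** (same cover, transition functions `g_ij^m`):
weights `h_i^m` (`h_i^m = |g_ij^m|² h_j^m`), and **its Chern form is `m` times that of `h`** in every frame,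
`(1/2iπ) ∂∂̄ log h_i^m = m · (1/2iπ) ∂∂̄ log h_i` (Voisin I, §3.3.1; Thm. 4.49 and §7.1.3: products of cocycles
present tensor products). [cite: VoisinHodgeI2002, §3.3.1 and §7.1.3] -/
theorem _root_.Literature.Geometry.Kaehler.HolomorphicLineBundle.HermitianMetric.exists_localChernForm_eq_smul_of_pow
    (h : L.HermitianMetric) (m : ℕ) (hU : ∀ i, L'.baseSet i = L.baseSet i)
    (hg : ∀ i j, ∀ x ∈ L.baseSet i ∩ L.baseSet j, L'.coordChange i j x = L.coordChange i j x ^ m) :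
    ∃ h' : L'.HermitianMetric, ∀ i, h'.localChernForm i = (m : ℂ) • h.localChernForm i := by
  refine ⟨⟨fun i x ↦ h.weight i x ^ m, fun i x hx ↦ pow_pos (h.weight_pos i x (by rwa [hU] at hx)) m,
    fun i ↦ by rw [hU]; exact (h.contMDiffOn_weight i).pow m, fun i j x hx ↦ ?_⟩, fun i ↦ ?_⟩
  · rw [hU, hU] at hx
    rw [hg i j x hx, h.weight_eq i j x hx, mul_pow, norm_pow, ← pow_mul, ← pow_mul, mul_comm 2 m]
  · have hfun : (MForm.ofFun 𝓘(ℝ, E) fun x ↦ (Real.log (h.weight i x ^ m) : ℂ)) =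
        (m : ℝ) • MForm.ofFun 𝓘(ℝ, E) fun x ↦ (Real.log (h.weight i x) : ℂ) := by
      funext x
      ext v
      change (Real.log (h.weight i x ^ m) : ℂ) = (m : ℝ) • (Real.log (h.weight i x) : ℂ)
      rw [Real.log_pow, ← Complex.coe_smul, smul_eq_mul]
      push_cast
      rfl
    have hJ : ∀ (c : ℝ) (α : MForm 𝓘(ℝ, E) M ℂ 1), (c • α).compJ = c • α.compJ := fun c α ↦ by
      funext x
      ext v
      rfl
    change (1 / (4 * Real.pi)) • mextDeriv (mextDeriv (MForm.ofFun 𝓘(ℝ, E) fun x ↦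
      (Real.log (h.weight i x ^ m) : ℂ))).compJ = (m : ℂ) • h.localChernForm i
    rw [HolomorphicLineBundle.HermitianMetric.localChernForm, hfun, mextDeriv_smul, hJ, mextDeriv_smul, smul_comm,
      ← Complex.coe_smul (m : ℝ), Complex.ofReal_natCast]

end Power

namespace HodgeModel

variable {n : ℕ} {X : SchemeOver ℂ}

/-- **`ch₁(L^{⊗m}) = m • ch₁(L)` in `H²(X(ℂ); ℂ)`** for holomorphic line cocycles `L`, `L' = L^{⊗m}` (same
cover, transition functions `g_ij^m`) on a Hodge model: `c₁` is represented by the Chern form of any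
Hermitian metric (Voisin I, §3.3.1 with Thm. 7.10; Chern–Weil, `HodgeModel.pullback_chernCharacter`), and the
Chern form of `h^{⊗m}` is `m` times that of `h`. [cite: VoisinHodgeI2002, §3.3.1 and Thm. 7.10]
[cite: Kobayashi1987, Ch. II §2 Thm. 2.16] -/
theorem chernCharacter_toSmoothCocycle_eq_smul_of_pow (A : HodgeModel n X) {ι : Type}
    (L L' : HolomorphicLineBundle ι A.model A.carrier) (m : ℕ) (hU : ∀ i, L'.baseSet i = L.baseSet i)
    (hg : ∀ i j, ∀ x ∈ L.baseSet i ∩ L.baseSet j, L'.coordChange i j x = L.coordChange i j x ^ m) :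
    A.chernCharacter L'.toSmoothCocycle 1 = (m : ℂ) • A.chernCharacter L.toSmoothCocycle 1 := by
  obtain ⟨h⟩ := L.nonempty_hermitianMetric
  obtain ⟨θ, hs, hc, hθ⟩ := h.exists_isChernForm
  obtain ⟨h', hh'⟩ := h.exists_localChernForm_eq_smul_of_pow m hU hg
  have hs' : IsSmoothForm ((m : ℂ) • θ) := hs.smul_complex _
  have hc' : IsClosedForm ((m : ℂ) • θ) := by
    rw [IsClosedForm, Literature.NumberTheory.Transcendental.mextDeriv_smul_complex_holds, hc, smul_zero]
  have hθ' : h'.IsChernForm ((m : ℂ) • θ) := fun i x hx ↦ by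
    rw [Pi.smul_apply, hθ i x (by rwa [hU] at hx), hh', Pi.smul_apply]
  apply A.pullback_injective (2 * 1)
  rw [A.pullback_chernCharacter L'.toSmoothCocycle 1 h'.chernConnection hs' hc'
      (h'.isChernCharacterForm_of_isChernForm hθ'), _root_.map_smul,
    A.pullback_chernCharacter L.toSmoothCocycle 1 h.chernConnection hs hc (h.isChernCharacterForm_of_isChernForm hθ),
    ← _root_.map_smul, ← _root_.map_smul]
  rfl

end HodgeModel

/-! ### The holomorphic isomorphism `(ψ^an)⁻¹𝒪_{ℙᴺ}(-1) ≅ 𝒪(-1)|_T^{⊗m}` from `ψ^*H ∼ m • D_Ψ` -/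

section Iso

variable {n N K : ℕ} {T : SchemeOver ℂ} [IsIntegral T.left]

/-- **Linearly equivalent divisors have analytically equivalent cocycles**, for the two cocycles at hand:
if `ψ^*H ∼ m • D_Ψ` for a dominant `ψ : T ⟶ ℙᴺ` and a closed immersion `Ψ : T ⟶ ℙᴷ` (`H = {x₀ = 0}`,
`D_Ψ = (Ψ^*x_{j₀})`), then the pulled-back tautological cocycle `(ψ^an)⁻¹𝒪_{ℙᴺ}(-1)` (transition functions
`ψ^*(xᵢ/xⱼ) = f_j/f_i`, `f_i = ψ^*(x₀/xᵢ)` the local equations of `ψ^*H`: the cocycle `𝒪_T(-ψ^*H)^an`) is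
holomorphically isomorphic (a holomorphic `CocycleIso`, Fritzsche–Grauert IV §2 (C)) to every cocycle `W`
on the cover `φ⁻¹(Ψ⁻¹D₊(x_a)(ℂ))` with transition functions `(Ψ^*(x_a/x_b))^m = (F_b/F_a)^m`,
`F_a = Ψ^*(x_{j₀}/x_a)` (the cocycle `𝒪_T(-m D_Ψ)^an = 𝒪(-1)|_T^{⊗m}`): the matrices are the units
`λ_{a i} = f_i h / F_a^m ∈ Γ(ψ⁻¹D₊(xᵢ) ∩ Ψ⁻¹D₊(x_a), 𝒪_T^×)` of the linear equivalence read on `T^an`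
(regular functions are holomorphic, Serre GAGA §2), and (C) `λ_{a i} f_j/f_i = (F_b/F_a)^m λ_{b j}` holds in
`K(T)` (Görtz–Wedhorn I, Prop. 11.21: `D ↦ 𝒪_X(D)` is a homomorphism inducing `CaCl X ≅ Pic X`).
[cite: GortzWedhorn2020, Prop. 11.21 and Section (11.9)] [cite: SerreGAGA1956, §2 n°6 and §3 n°9]
[cite: VoisinHodgeI2002, §3.3.2 and Thm. 4.49] -/
theorem analyticallyEquivalent_tautologicalBundle_pullback_of_linEquiv (hT : IsSmoothProjective n T)
    (A : HodgeModel n T) (B : HodgeModel N (projectiveSpace N ℂ))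
    [IsClosedImmersion (𝟙 (projectiveSpace N ℂ) : projectiveSpace N ℂ ⟶ _).left]
    (Ψ : T ⟶ projectiveSpace K ℂ) [IsClosedImmersion Ψ.left] (ψ : T ⟶ projectiveSpace N ℂ)
    (hψ : IsDominant ψ.left) (j₀ : Fin (K + 1)) (hj₀ : genericPoint T.left ∈ (GeneratingSections.ofHom Ψ.left).U j₀)
    (m : ℕ) (hlin : (@CartierDivisor.pullback _ _ (ProjSpace.hyperplane N ℂ) T.left _ ψ.left hψ).LinEquiv
      (m • (GeneratingSections.ofHom Ψ.left).divisor j₀ hj₀))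
    (W : SmoothComplexVectorBundle (Fin (K + 1)) A.model A.carrier 1)
    (hWU : ∀ a, W.baseSet a = chartDom Ψ A.toComplexPoints a)
    (hWg : ∀ a b, ∀ x ∈ W.baseSet a ∩ W.baseSet b, W.coordChange a b x 0 0 = coordFun Ψ A.toComplexPoints b x a ^ m) :
    SmoothComplexVectorBundle.AnalyticallyEquivalent
      ((tautologicalBundle (𝟙 (projectiveSpace N ℂ)) B.isAnalytification).pullback (HodgeModel.anMap B A ψ)
        (HodgeModel.contMDiff_anMap B A ψ hT (isSmoothProjective_projectiveSpace' N))) W := by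
  classical
  set φ := A.toComplexPoints with hφ
  set G₁ : GeneratingSections (Fin (N + 1)) T.left := GeneratingSections.affineChartData ψ with hG₁
  set G₂ : GeneratingSections (Fin (K + 1)) T.left := GeneratingSections.affineChartData Ψ with hG₂
  obtain ⟨h, -, hunit⟩ := GeneratingSections.exists_isUnitAt_of_linEquiv_hyperplane ψ hψ Ψ j₀ hj₀ m hlin
  have ho : genericPoint T.left ∈ G₁.U 0 := by
    haveI : IsIntegral (projectiveSpace N ℂ).left := ProjSpace.isIntegral N ℂ
    haveI : IsDominant ψ.left := hψ
    exact genericPoint_mem_preimage ψ.left (ProjSpace.genericPoint_mem_U 0)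
  -- the units `λ_{a i} = f_i h / F_a^m`, regular on `ψ⁻¹D₊(xᵢ) ∩ Ψ⁻¹D₊(x_a)`, read on `T^an`
  have hreg : ∀ (i : Fin (N + 1)) (a : Fin (K + 1)) (hO : genericPoint T.left ∈ G₁.U i ⊓ G₂.U a),
      ∀ y ∈ G₁.U i ⊓ G₂.U a, IsRegularAt y (G₁.ratioFn i 0 hO.1 * h / G₂.ratioFn a j₀ hO.2 ^ m) :=
    fun i a hO y hy ↦ (hunit i a y hy.1 hy.2).isRegularAt
  obtain ⟨u, hu⟩ : ∃ u : Fin (N + 1) → Fin (K + 1) → A.carrier → ℂ, u = fun i a x ↦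
      if hO : genericPoint T.left ∈ G₁.U i ⊓ G₂.U a then
        evalOrZero (G₁.U i ⊓ G₂.U a) (sectionOf hO _ (hreg i a hO)) (φ x) else 0 := ⟨_, rfl⟩
  have hu_of_mem : ∀ {i : Fin (N + 1)} {a : Fin (K + 1)} {x : A.carrier} (hx : (φ x).pt ∈ G₁.U i ⊓ G₂.U a),
      u i a x = evalOrZero (G₁.U i ⊓ G₂.U a) (sectionOf (genericPoint_mem_of_mem hx) _
        (hreg i a (genericPoint_mem_of_mem hx))) (φ x) := fun hx ↦ by
    rw [hu]
    exact dif_pos (genericPoint_mem_of_mem hx)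
  -- membership in the trivialising sets
  have hV : ∀ {i : Fin (N + 1)} {x : A.carrier}, x ∈ ((tautologicalBundle (𝟙 (projectiveSpace N ℂ))
      B.isAnalytification).pullback (HodgeModel.anMap B A ψ)
        (HodgeModel.contMDiff_anMap B A ψ hT (isSmoothProjective_projectiveSpace' N))).baseSet i →
      (φ x).pt ∈ G₁.U i :=
    fun {i x} hx ↦ pt_mem_of_mem_chartDom ((mem_tautologicalBundle_pullback_anMap_baseSet_iff hT A B ψ i x).1 hx)
  have hW : ∀ {a : Fin (K + 1)} {x : A.carrier}, x ∈ W.baseSet a → (φ x).pt ∈ G₂.U a := fun {a x} hx ↦ by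
    rw [hWU] at hx
    exact pt_mem_of_mem_chartDom hx
  refine ⟨⟨fun a i x ↦ Matrix.of fun _ _ ↦ u i a x, fun a i x hx ↦ ?_, fun a b i j x hx ↦ ?_⟩, fun a i p q ↦ ?_⟩
  · -- `λ_{a i}(x) ∈ GL₁(ℂ)`: a unit of `𝒪_{T, φ x}` does not vanish at `φ x`
    rw [Matrix.isUnit_iff_isUnit_det, Matrix.det_unique, Matrix.of_apply, hu_of_mem ⟨hV hx.1, hW hx.2⟩]
    exact isUnit_iff_ne_zero.2 (evalOrZero_sectionOf_ne_zero _ _ ⟨hV hx.1, hW hx.2⟩ (hunit i a _ (hV hx.1) (hW hx.2)))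
  · -- condition (C): `λ_{a i} · ψ^*(xᵢ/xⱼ) = (Ψ^*(x_a/x_b))^m · λ_{b j}`, an identity in `K(T)`
    obtain ⟨⟨hi, hj⟩, ha, hb⟩ := hx
    ext p q
    rw [Subsingleton.elim p 0, Subsingleton.elim q 0]
    simp only [Matrix.mul_apply, Fin.sum_univ_one, Matrix.of_apply]
    have hia : (φ x).pt ∈ G₁.U i ⊓ G₂.U a := ⟨hV hi, hW ha⟩
    have hjb : (φ x).pt ∈ G₁.U j ⊓ G₂.U b := ⟨hV hj, hW hb⟩
    rw [tautologicalBundle_pullback_anMap_coordChange_apply hT A B ψ, hWg a b x ⟨ha, hb⟩, hu_of_mem hia, hu_of_mem hjb]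
    change _ * evalOrZero (G₁.U j) (G₁.ratio j i) (φ x) = evalOrZero (G₂.U b) (G₂.ratio b a) (φ x) ^ m * _
    refine evalOrZero_mul_eq_pow_mul_of_ofSection _ _ _ _ hia (hV hj) (hW hb) hjb m ?_
    rw [ofSection_sectionOf, ofSection_sectionOf]
    exact GeneratingSections.ratioFn_mul_div_pow_mul_ratioFn G₁ G₂ h m _ _ ho _ _ hj₀
  · -- holomorphy of `λ_{a i}` on `φ⁻¹((ψ⁻¹D₊(xᵢ) ∩ Ψ⁻¹D₊(x_a))(ℂ))` (regular functions are holomorphic)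
    simp only [Matrix.of_apply]
    by_cases hO : genericPoint T.left ∈ G₁.U i ⊓ G₂.U a
    · have heq : (fun x ↦ u i a x) = fun x ↦ evalOrZero (G₁.U i ⊓ G₂.U a) (sectionOf hO _ (hreg i a hO)) (φ x) := by
        funext x
        rw [hu]
        exact dif_pos hO
      rw [heq]
      exact (IsAnalytification.mdifferentiableOn_evalOrZero_opens_holds A.isAnalytification (G₁.U i ⊓ G₂.U a) _).mono
        fun x hx ↦ ⟨hV hx.1, hW hx.2⟩
    · exact fun x hx ↦ absurd (genericPoint_mem_of_mem (⟨hV hx.1, hW hx.2⟩ : (φ x).pt ∈ G₁.U i ⊓ G₂.U a)) hO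

end Iso

/-! ### The theorem -/

/-- **Linear equivalence of hyperplane divisors transports to `ch₁` of the tautological cocycles.** Let `T`
be smooth projective with Hodge model `A`, `Ψ : T ⟶ ℙᴷ` a closed immersion with hyperplane divisor
`D_Ψ = (Ψ^*x_{j₀})` (`GeneratingSections.divisor`), and `ψ : T ⟶ ℙᴺ` dominant with pulled-back hyperplane
divisor `ψ^*H` (`CartierDivisor.pullback` of `ProjSpace.hyperplane`). If `ψ^*H ∼ m • D_Ψ`, then the first Chern
character of the tautological cocycle `𝒪_{ℙᴺ}(-1)` pulled back along `ψ^an` equals `m` times that of the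
tautological cocycle `𝒪(-1)|_T` of `Ψ`: `ch₁((ψ^an)⁻¹𝒪(-1)) = m • ch₁(𝒪(-1)|_T)` in `H²(T(ℂ); ℂ)` — the two
cocycles are `𝒪_T(-ψ^*H)^an ≅ 𝒪_T(-m D_Ψ)^an = (𝒪(-1)|_T)^{⊗m}` (Görtz–Wedhorn I, Prop. 11.21; the
holomorphic isomorphism `analyticallyEquivalent_tautologicalBundle_pullback_of_linEquiv`), isomorphic
cocycles have the same Chern character (`CocycleIso.chernCharacterDeRham_eq`, Kobayashi II §1), and
`ch₁(L^{⊗m}) = m ch₁(L)` (`HodgeModel.chernCharacter_toSmoothCocycle_eq_smul_of_pow`, Voisin I §3.3.1).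
[cite: VoisinHodgeI2002, §3.3.1, §11.1.2 and Thm. 11.33] [cite: GortzWedhorn2020, Prop. 11.21 and Def. 11.49]
[cite: Kobayashi1987, Ch. II §1 Axiom 2 and §2 Thm. 2.16] -/
theorem HodgeModel.chernCharacter_tautologicalBundle_pullback_eq_smul_of_linEquiv :
    ∀ ⦃n N K : ℕ⦄ ⦃T : Motives.SchemeOver ℂ⦄ [IsIntegral T.left] (hT : Motives.IsSmoothProjective n T)
      (A : HodgeModel n T) (B : HodgeModel N (Motives.projectiveSpace N ℂ))
      [IsClosedImmersion (𝟙 (Motives.projectiveSpace N ℂ) : Motives.projectiveSpace N ℂ ⟶ _).left]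
      (Ψ : T ⟶ Motives.projectiveSpace K ℂ) [IsClosedImmersion Ψ.left]
      (ψ : T ⟶ Motives.projectiveSpace N ℂ) (hψ : IsDominant ψ.left) (j₀ : Fin (K + 1))
      (hj₀ : genericPoint T.left ∈ (Motives.GeneratingSections.ofHom Ψ.left).U j₀) (m : ℕ),
      (@Motives.CartierDivisor.pullback _ _ (Motives.ProjSpace.hyperplane N ℂ) T.left _ ψ.left hψ).LinEquiv
          (m • (Motives.GeneratingSections.ofHom Ψ.left).divisor j₀ hj₀) →
      A.chernCharacter
          ((Motives.AnalytificationKaehler.tautologicalBundle (𝟙 (Motives.projectiveSpace N ℂ))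
              B.isAnalytification).pullback (HodgeModel.anMap B A ψ)
            (HodgeModel.contMDiff_anMap B A ψ hT (isSmoothProjective_projectiveSpace' N))) 1 =
        (m : ℂ) • A.chernCharacter (Motives.AnalytificationKaehler.tautologicalBundle Ψ A.isAnalytification) 1 := by
  intro n N K T _ hT A B _ Ψ _ ψ hψ j₀ hj₀ m hlin
  -- `𝒪(-1)|_T` as a holomorphic line cocycle `L` (Voisin's convention), and its tensor power `L^{⊗m}`
  set L : HolomorphicLineBundle (Fin (K + 1)) A.model A.carrier :=
    (tautologicalBundle Ψ A.isAnalytification).toHolomorphicLineBundle (tautologicalBundle_isHolomorphic Ψ _) with hL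
  let L' : HolomorphicLineBundle (Fin (K + 1)) A.model A.carrier :=
    { baseSet := L.baseSet
      isOpen_baseSet := L.isOpen_baseSet
      exists_mem_baseSet := L.exists_mem_baseSet
      coordChange := fun a b x ↦ L.coordChange a b x ^ m
      mdifferentiableOn_coordChange := fun a b ↦ (L.mdifferentiableOn_coordChange a b).pow m
      coordChange_ne_zero := fun a b x hx ↦ pow_ne_zero m (L.coordChange_ne_zero a b x hx)
      coordChange_comp := fun a b c x hx ↦ by rw [← mul_pow, L.coordChange_comp a b c x hx] }
  have hL' : A.chernCharacter L'.toSmoothCocycle 1 = (m : ℂ) • A.chernCharacter L.toSmoothCocycle 1 :=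
    A.chernCharacter_toSmoothCocycle_eq_smul_of_pow L L' m (fun _ ↦ rfl) fun _ _ _ _ ↦ rfl
  obtain ⟨Φ, hΦ⟩ := analyticallyEquivalent_tautologicalBundle_pullback_of_linEquiv hT A B Ψ ψ hψ j₀ hj₀ m hlin
    L'.toSmoothCocycle (fun _ ↦ rfl) fun _ _ _ _ ↦ rfl
  change _ = (m : ℂ) • A.chernCharacter L.toSmoothCocycle 1
  rw [← hL']
  apply A.pullback_injective (2 * 1)
  rw [A.pullback_chernCharacter_eq, A.pullback_chernCharacter_eq,
    Φ.chernCharacterDeRham_eq (SmoothComplexVectorBundle.mk_eq_mk_of_isChernCharacterForm_holds A.model A.carrier)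
      hΦ.isSmooth 1]

end Literature.AlgebraicGeometry.HodgeTheory

end
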